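import Mathlib
import HarnessLib
import Summits.ValiantsHypothesis.ValiantsHypothesis.Theorems.LacunarySymmetroidMatrixDescartesOsculationLawPeelBranchArcCalculus

/-!
# ValiantsHypothesis / LacunarySymmetroid — crux `MatrixDescartes` (stmt-ValiantsHypothesis-18050, V1),
# line `Cruxes/MatrixDescartes/Lines/osculation_law.lean` («osculation-law»), stub `stub_recursion`, R6(a) witness:
# POLYNOMIAL BRANCHES WITH ONE-SIGN COEFFICIENTS NEVER OSCULATE

Generic curve facts for the NON-EMPTINESS of the node-GP family (val-lit-p7 g13's memo
`HOME/lmr/NOTE-p7g13-18050-GP-density-sizing.md` §3, ROUTE′ (4); builders p4/p7/p8/port-3, desk RULING #286): if a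
branch of the spectral curve `Φ = 0` is the graph of a POLYNOMIAL `f(t) = Σ_l A_l t^{e_l}` with coefficients of one sign
and at least two distinct exponents, then the bordered log-Hessian does not vanish at its smooth points — the graph is
strictly convex in `(log t, log b)`:
* `logWronskian_sum_eq` — `F·θ²F − (θF)² = ½ Σ_{l,l′} A_l A_{l′} (e_l − e_{l′})² t^{e_l + e_{l′}}` for
  `F = Σ_l A_l t^{e_l}` (`θ = t·d/dt`), as an identity of real numbers at `t`;
* `logWronskian_sum_pos` / `logWronskian_sum_pos_of_neg` — it is `> 0` for `t > 0`, coefficients of ONE sign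
  (`A_l ≥ 0`, resp. `A_l ≤ 0`), and two indices with distinct exponents and nonzero coefficients;
* `eval_logHessian_ne_zero_of_polynomial_branch` — along a polynomial branch `b = f(t)` of `Φ = 0` with `∂_bΦ ≠ 0`,
  `H(Φ)(t, f t) = −t·f(t)·(∂_bΦ)³·(f f′ + t f f″ − t f′²)` (p7 g12's `logHessian_eval_eq`), hence `≠ 0` as soon as
  `t·(f f′ + t f f″ − t f′²) = f·θ²f − (θf)² ≠ 0`.
Honest framing: helper lemmas toward the OPEN stub `stub_recursion` (its general-position residue); the osculation
LAW, `MatrixDescartes`, Conjecture B and `VP ≠ VNP` are NOT proved.  No definitions, no named facts.  (val-lit-p4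
g13, helper `--supports stmt-ValiantsHypothesis-18050`.)
-/

-- `Summit.ValiantsHypothesis.ValiantsHypothesis.…` is the tree's mandated single-conjunct layout (Sub = Summit).
set_option linter.dupNamespace false

noncomputable section

namespace Summit.ValiantsHypothesis.ValiantsHypothesis.Theorems.LacunarySymmetroidMatrixDescartes

open Polynomial Set
open MvPolynomial (pderiv)
open scoped BigOperators

namespace OsculationRecursion

/-! ### Log-convexity of positive fewnomials -/

/-- **The log-Wronskian of a positive sum of monomials**, as a symmetric double sum:
`(Σ A_l t^{e_l})·(Σ A_l e_l² t^{e_l}) − (Σ A_l e_l t^{e_l})² = ½ Σ_{l,l′} A_l A_{l′} (e_l − e_{l′})² t^{e_l+e_{l′}}`.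
[folklore] -/
theorem logWronskian_sum_eq {n : ℕ} (A : Fin n → ℝ) (e : Fin n → ℕ) (t : ℝ) :
    (∑ l, A l * t ^ e l) * (∑ l, A l * ((e l : ℝ) ^ 2) * t ^ e l) - (∑ l, A l * (e l : ℝ) * t ^ e l) ^ 2 =
      (1 / 2) * ∑ l, ∑ l', A l * A l' * ((e l : ℝ) - e l') ^ 2 * t ^ (e l + e l') := by
  -- both sides as double sums of `g l l' := A_l A_{l'} (e_{l'}² − e_l e_{l'}) t^{e_l + e_{l'}}`
  have hL : (∑ l, A l * t ^ e l) * (∑ l, A l * ((e l : ℝ) ^ 2) * t ^ e l) - (∑ l, A l * (e l : ℝ) * t ^ e l) ^ 2 =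
      ∑ l, ∑ l', A l * A l' * ((e l' : ℝ) ^ 2 - e l * e l') * t ^ (e l + e l') := by
    rw [Finset.sum_mul_sum, sq, Finset.sum_mul_sum, ← Finset.sum_sub_distrib]
    refine Finset.sum_congr rfl fun l _ => ?_
    rw [← Finset.sum_sub_distrib]
    refine Finset.sum_congr rfl fun l' _ => ?_
    rw [pow_add]; ring
  have hR : ∑ l, ∑ l', A l * A l' * ((e l : ℝ) - e l') ^ 2 * t ^ (e l + e l') =
      (∑ l, ∑ l', A l * A l' * ((e l' : ℝ) ^ 2 - e l * e l') * t ^ (e l + e l')) +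
        ∑ l, ∑ l', A l' * A l * ((e l : ℝ) ^ 2 - e l' * e l) * t ^ (e l' + e l) := by
    rw [← Finset.sum_add_distrib]
    refine Finset.sum_congr rfl fun l _ => ?_
    rw [← Finset.sum_add_distrib]
    refine Finset.sum_congr rfl fun l' _ => ?_
    rw [add_comm (e l') (e l)]; ring
  have hsymm : ∑ l, ∑ l', A l' * A l * ((e l : ℝ) ^ 2 - e l' * e l) * t ^ (e l' + e l) =
      ∑ l, ∑ l', A l * A l' * ((e l' : ℝ) ^ 2 - e l * e l') * t ^ (e l + e l') := Finset.sum_comm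
  rw [hL, hR, hsymm]
  ring

/-- **Strict log-convexity**: for `t > 0`, nonnegative coefficients and two positive ones at distinct exponents
the log-Wronskian is positive. [folklore] -/
theorem logWronskian_sum_pos {n : ℕ} (A : Fin n → ℝ) (e : Fin n → ℕ) {t : ℝ} (ht : 0 < t)
    (hA : ∀ l, 0 ≤ A l) {i j : Fin n} (hi : 0 < A i) (hj : 0 < A j) (hij : e i ≠ e j) :
    0 < (∑ l, A l * t ^ e l) * (∑ l, A l * ((e l : ℝ) ^ 2) * t ^ e l) - (∑ l, A l * (e l : ℝ) * t ^ e l) ^ 2 := by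
  rw [logWronskian_sum_eq]
  have hnn : ∀ l l', 0 ≤ A l * A l' * ((e l : ℝ) - e l') ^ 2 * t ^ (e l + e l') := fun l l' =>
    mul_nonneg (mul_nonneg (mul_nonneg (hA l) (hA l')) (sq_nonneg _)) (pow_nonneg ht.le _)
  have hpos : 0 < A i * A j * ((e i : ℝ) - e j) ^ 2 * t ^ (e i + e j) := by
    refine mul_pos (mul_pos (mul_pos hi hj) ?_) (pow_pos ht _)
    have : ((e i : ℝ) - e j) ≠ 0 := sub_ne_zero.2 (by exact_mod_cast hij)
    positivity
  have h1 : A i * A j * ((e i : ℝ) - e j) ^ 2 * t ^ (e i + e j) ≤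
      ∑ l', A i * A l' * ((e i : ℝ) - e l') ^ 2 * t ^ (e i + e l') :=
    Finset.single_le_sum (f := fun l' => A i * A l' * ((e i : ℝ) - e l') ^ 2 * t ^ (e i + e l'))
      (fun l' _ => hnn i l') (Finset.mem_univ j)
  have h2 : ∑ l', A i * A l' * ((e i : ℝ) - e l') ^ 2 * t ^ (e i + e l') ≤
      ∑ l, ∑ l', A l * A l' * ((e l : ℝ) - e l') ^ 2 * t ^ (e l + e l') :=
    Finset.single_le_sum (f := fun l => ∑ l', A l * A l' * ((e l : ℝ) - e l') ^ 2 * t ^ (e l + e l'))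
      (fun l _ => Finset.sum_nonneg fun l' _ => hnn l l') (Finset.mem_univ i)
  linarith

/-- The same for NONPOSITIVE coefficients (the log-Wronskian is quadratic in the coefficients). [folklore] -/
theorem logWronskian_sum_pos_of_neg {n : ℕ} (A : Fin n → ℝ) (e : Fin n → ℕ) {t : ℝ} (ht : 0 < t)
    (hA : ∀ l, A l ≤ 0) {i j : Fin n} (hi : A i < 0) (hj : A j < 0) (hij : e i ≠ e j) :
    0 < (∑ l, A l * t ^ e l) * (∑ l, A l * ((e l : ℝ) ^ 2) * t ^ e l) - (∑ l, A l * (e l : ℝ) * t ^ e l) ^ 2 := by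
  have h := logWronskian_sum_pos (fun l => -A l) e ht (fun l => neg_nonneg.2 (hA l)) (neg_pos.2 hi) (neg_pos.2 hj)
    hij
  have e1 : ∑ l, -A l * t ^ e l = -∑ l, A l * t ^ e l := by
    rw [← Finset.sum_neg_distrib]; exact Finset.sum_congr rfl fun l _ => by ring
  have e2 : ∑ l, -A l * ((e l : ℝ) ^ 2) * t ^ e l = -∑ l, A l * ((e l : ℝ) ^ 2) * t ^ e l := by
    rw [← Finset.sum_neg_distrib]; exact Finset.sum_congr rfl fun l _ => by ring
  have e3 : ∑ l, -A l * (e l : ℝ) * t ^ e l = -∑ l, A l * (e l : ℝ) * t ^ e l := by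
    rw [← Finset.sum_neg_distrib]; exact Finset.sum_congr rfl fun l _ => by ring
  rw [e1, e2, e3] at h
  linarith [h]

/-! ### Polynomial branches -/

/-- `t·(f f′ + t f f″ − t f′²) = f·θ²f − (θf)²` for a sum of monomials, at a point. [folklore] -/
theorem branch_curvature_sum_eq {n : ℕ} (A : Fin n → ℝ) (e : Fin n → ℕ) (t : ℝ) :
    t * ((∑ l, Polynomial.C (A l) * X ^ e l : ℝ[X]).eval t * (derivative (∑ l, Polynomial.C (A l) * X ^ e l : ℝ[X])).eval t
        + t * (∑ l, Polynomial.C (A l) * X ^ e l : ℝ[X]).eval t *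
            (derivative (derivative (∑ l, Polynomial.C (A l) * X ^ e l : ℝ[X]))).eval t
        - t * (derivative (∑ l, Polynomial.C (A l) * X ^ e l : ℝ[X])).eval t ^ 2) =
      (∑ l, A l * t ^ e l) * (∑ l, A l * ((e l : ℝ) ^ 2) * t ^ e l) - (∑ l, A l * (e l : ℝ) * t ^ e l) ^ 2 := by
  -- evaluate the three polynomials as sums
  have h0 : (∑ l, Polynomial.C (A l) * X ^ e l : ℝ[X]).eval t = ∑ l, A l * t ^ e l := by
    rw [eval_finsetSum]; simp
  have h1 : t * (derivative (∑ l, Polynomial.C (A l) * X ^ e l : ℝ[X])).eval t = ∑ l, A l * (e l : ℝ) * t ^ e l := by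
    rw [derivative_sum, eval_finsetSum, Finset.mul_sum]
    refine Finset.sum_congr rfl fun l _ => ?_
    rw [derivative_C_mul_X_pow, eval_mul, eval_C, eval_pow, eval_X]
    rcases Nat.eq_zero_or_pos (e l) with h | h
    · simp [h]
    · have : t * t ^ (e l - 1) = t ^ e l := by
        rw [← pow_succ']; congr 1; omega
      calc t * (A l * (e l : ℝ) * t ^ (e l - 1)) = A l * (e l : ℝ) * (t * t ^ (e l - 1)) := by ring
        _ = A l * (e l : ℝ) * t ^ e l := by rw [this]
  have h2 : t * t * (derivative (derivative (∑ l, Polynomial.C (A l) * X ^ e l : ℝ[X]))).eval t =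
      ∑ l, A l * ((e l : ℝ) * ((e l : ℝ) - 1)) * t ^ e l := by
    rw [derivative_sum, derivative_sum, eval_finsetSum, Finset.mul_sum]
    refine Finset.sum_congr rfl fun l _ => ?_
    rw [derivative_C_mul_X_pow, derivative_C_mul_X_pow, eval_mul, eval_C, eval_pow, eval_X]
    rcases Nat.lt_or_ge (e l) 2 with h | h
    · interval_cases hel : e l
      · simp
      · simp
    · have : t * t * t ^ (e l - 1 - 1) = t ^ e l := by
        rw [← pow_two, ← pow_add]; congr 1; omega
      have hc : (((e l - 1 : ℕ) : ℝ)) = (e l : ℝ) - 1 := by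
        rw [Nat.cast_sub (by omega)]; simp
      calc t * t * (A l * (e l : ℝ) * ((e l - 1 : ℕ) : ℝ) * t ^ (e l - 1 - 1))
          = A l * ((e l : ℝ) * ((e l - 1 : ℕ) : ℝ)) * (t * t * t ^ (e l - 1 - 1)) := by ring
        _ = A l * ((e l : ℝ) * ((e l : ℝ) - 1)) * t ^ e l := by rw [this, hc]
  -- assemble: t(f f' + t f f'' − t f'²) = f·(tf') + f·(t²f'') − (tf')² = f θf + f(θ²f − θf) − (θf)²
  have key : t * ((∑ l, Polynomial.C (A l) * X ^ e l : ℝ[X]).eval t * (derivative (∑ l, Polynomial.C (A l) * X ^ e l : ℝ[X])).eval t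
        + t * (∑ l, Polynomial.C (A l) * X ^ e l : ℝ[X]).eval t *
            (derivative (derivative (∑ l, Polynomial.C (A l) * X ^ e l : ℝ[X]))).eval t
        - t * (derivative (∑ l, Polynomial.C (A l) * X ^ e l : ℝ[X])).eval t ^ 2) =
      (∑ l, A l * t ^ e l) * (∑ l, A l * (e l : ℝ) * t ^ e l)
        + (∑ l, A l * t ^ e l) * (∑ l, A l * ((e l : ℝ) * ((e l : ℝ) - 1)) * t ^ e l)
        - (∑ l, A l * (e l : ℝ) * t ^ e l) ^ 2 := by
    rw [← h0, ← h1, ← h2]; ring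
  rw [key]
  have h3 : (∑ l, A l * (e l : ℝ) * t ^ e l) + (∑ l, A l * ((e l : ℝ) * ((e l : ℝ) - 1)) * t ^ e l) =
      ∑ l, A l * ((e l : ℝ) ^ 2) * t ^ e l := by
    rw [← Finset.sum_add_distrib]
    refine Finset.sum_congr rfl fun l _ => ?_
    ring
  rw [← h3]
  ring

/-- **A polynomial branch with coefficients of one sign never osculates.**  Let `f = Σ_l A_l X^{e_l}` with all
`A_l ≥ 0` or all `A_l ≤ 0` and two nonzero coefficients at distinct exponents, let `Φ(s, f(s)) = 0` for `s` in an open interval containing `t > 0`, and let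
`∂_bΦ(t, f t) ≠ 0`.  Then the bordered log-Hessian `H(Φ)(t, f t) ≠ 0`. [folklore; p7 g12's `logHessian_eval_eq`] -/
theorem eval_logHessian_ne_zero_of_polynomial_branch (Φ : MvPolynomial (Fin 2) ℝ) {n : ℕ} (A : Fin n → ℝ)
    (e : Fin n → ℕ) {i j : Fin n}
    (hA : ((∀ l, 0 ≤ A l) ∧ 0 < A i ∧ 0 < A j) ∨ ((∀ l, A l ≤ 0) ∧ A i < 0 ∧ A j < 0)) (hij : e i ≠ e j)
    {α ω t : ℝ} (ht : t ∈ Ioo α ω) (ht0 : 0 < t)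
    (hΦ : ∀ s ∈ Ioo α ω, MvPolynomial.eval ![s, (∑ l, Polynomial.C (A l) * X ^ e l : ℝ[X]).eval s] Φ = 0)
    (hΦb : MvPolynomial.eval ![t, (∑ l, Polynomial.C (A l) * X ^ e l : ℝ[X]).eval t] (pderiv 1 Φ) ≠ 0) :
    MvPolynomial.eval ![t, (∑ l, Polynomial.C (A l) * X ^ e l : ℝ[X]).eval t]
        (MvPolynomial.X 0 * MvPolynomial.pderiv 0 (MvPolynomial.X 0 * MvPolynomial.pderiv 0 Φ)
            * (MvPolynomial.X 1 * MvPolynomial.pderiv 1 Φ) ^ 2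
          - 2 * (MvPolynomial.X 0 * MvPolynomial.pderiv 0 (MvPolynomial.X 1 * MvPolynomial.pderiv 1 Φ))
            * (MvPolynomial.X 0 * MvPolynomial.pderiv 0 Φ) * (MvPolynomial.X 1 * MvPolynomial.pderiv 1 Φ)
          + MvPolynomial.X 1 * MvPolynomial.pderiv 1 (MvPolynomial.X 1 * MvPolynomial.pderiv 1 Φ)
            * (MvPolynomial.X 0 * MvPolynomial.pderiv 0 Φ) ^ 2) ≠ 0 := by
  set f : ℝ[X] := ∑ l, Polynomial.C (A l) * X ^ e l with hf
  have hβ : ∀ s ∈ Ioo α ω, HasDerivAt (fun u => f.eval u) ((derivative f).eval s) s :=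
    fun s _ => Polynomial.hasDerivAt f s
  have hβ₁ : ∀ s ∈ Ioo α ω, HasDerivAt (fun u => (derivative f).eval u) ((derivative (derivative f)).eval s) s :=
    fun s _ => Polynomial.hasDerivAt (derivative f) s
  have h1 := OsculationPeel.branch_first_order Φ hβ hΦ ht
  have h2 := OsculationPeel.branch_second_order Φ hβ hβ₁ hΦ ht
  rw [OsculationPeel.logHessian_eval_eq Φ t (f.eval t) ((derivative f).eval t) ((derivative (derivative f)).eval t) h1 h2]
  -- the branch value is nonzero and the curvature factor is positive (coefficients of one sign)
  have hfeval : f.eval t = ∑ l, A l * t ^ e l := by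
    rw [hf, eval_finsetSum]
    exact Finset.sum_congr rfl fun l _ => by rw [eval_mul, eval_C, eval_pow, eval_X]
  have hfne : f.eval t ≠ 0 := by
    rw [hfeval]
    rcases hA with ⟨hA, hi, -⟩ | ⟨hA, hi, -⟩
    · exact (Finset.sum_pos' (fun l _ => mul_nonneg (hA l) (pow_pos ht0 _).le)
        ⟨i, Finset.mem_univ i, mul_pos hi (pow_pos ht0 _)⟩).ne'
    · have : 0 < ∑ l, -(A l * t ^ e l) :=
        Finset.sum_pos' (fun l _ => neg_nonneg.2 (mul_nonpos_of_nonpos_of_nonneg (hA l) (pow_pos ht0 _).le))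
          ⟨i, Finset.mem_univ i, neg_pos.2 (mul_neg_of_neg_of_pos hi (pow_pos ht0 _))⟩
      rw [Finset.sum_neg_distrib] at this
      exact (neg_pos.1 this).ne
  have hW : 0 < (∑ l, A l * t ^ e l) * (∑ l, A l * ((e l : ℝ) ^ 2) * t ^ e l)
      - (∑ l, A l * (e l : ℝ) * t ^ e l) ^ 2 := by
    rcases hA with ⟨hA, hi, hj⟩ | ⟨hA, hi, hj⟩
    · exact logWronskian_sum_pos A e ht0 hA hi hj hij
    · exact logWronskian_sum_pos_of_neg A e ht0 hA hi hj hij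
  rw [← branch_curvature_sum_eq A e t, ← hf] at hW
  have hcurv : f.eval t * (derivative f).eval t + t * f.eval t * (derivative (derivative f)).eval t
      - t * (derivative f).eval t ^ 2 ≠ 0 := by
    intro h0
    have : t * (f.eval t * (derivative f).eval t + t * f.eval t * (derivative (derivative f)).eval t
        - t * (derivative f).eval t ^ 2) = 0 := by rw [h0, mul_zero]
    rw [show t * (f.eval t * (derivative f).eval t + t * f.eval t * (derivative (derivative f)).eval t
        - t * (derivative f).eval t ^ 2) =
        t * (f.eval t * (derivative f).eval t + t * f.eval t * (derivative (derivative f)).eval t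
          - t * (derivative f).eval t ^ 2) from rfl] at this
    have e1 : t * (f.eval t * (derivative f).eval t + t * f.eval t * (derivative (derivative f)).eval t
        - t * (derivative f).eval t ^ 2) =
        t * (f.eval t * (derivative f).eval t) + t * f.eval t * (derivative (derivative f)).eval t * t
          - t * (derivative f).eval t ^ 2 * t := by ring
    linarith [hW, e1]
  refine neg_ne_zero.2 (mul_ne_zero (mul_ne_zero (mul_ne_zero ht0.ne' hfne) (pow_ne_zero 3 hΦb)) hcurv)

end OsculationRecursion

end Summit.ValiantsHypothesis.ValiantsHypothesis.Theorems.LacunarySymmetroidMatrixDescartes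

end
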